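import Literature.NumberTheory.Rogawski1990.ArchStableOrbitalFamilyHJunction   -- ★ p849802 (LH3-p02) PART 2b: `measure_box_partner_eq_of_image_eq`, `chartTorusH_eq_centralizer_of_mem_regS`; brings ★ chart tori∕boxes, `archStableCentralizerEquiv`
import Literature.NumberTheory.Rogawski1990.ArchEndoscopicAtlasNormPair          -- ★ (LH3-p04) place components `map_evalC_endoEmbArch_endoTorus` ∕ `map_evalC_gprimeTorus`, Cayley∕boost∕monomial kit
import Literature.NumberTheory.Automorphic.ArchInnerFormChartMeasures              -- ★ (T-MEAS-G): `chartTorusG`, `chartBoxImgG`, `chartTorusG_le_centralizer`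
import Literature.NumberTheory.Rogawski1990.ArchTransfFamily                       -- ★ p849747 (LH7-p02): `slotPerm`, `partnerPerms`
import HarnessLib

/-!
# (BOX-COH) The stable centraliser transport carries the `H`-chart box onto the partner `G′`-chart box — the two junction scalars of one packet coincide
# (Rogawski 1990 §1.7, §4.3 (4.3.1), §8.2; Shelstad 1979 §4; Langlands–Shelstad 1987 §1.3–1.4)

Topic `NumberTheory/Rogawski1990`; namespace `Literature.NumberTheory.Rogawski1990` (place-wise matrix lemmas in `Literature.NumberTheory.Automorphic.UnitaryGroup`).
THEOREMS ONLY (no definition, no instance, no notation, no axiom, no named fact, no `sorry`).  Cell `pub/hodgecm-mathlib`, crux H413 (`stmt-HodgeConjecture-24833`), F0∕P3c line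
LH3 (closer stub `stub_N9`, DIRECT ROAD), organ R3 (BOX-COH) of the O-READ partition (LH3-plan (g2) 2026-09-02T06:28:37Z (5) ∕ 06:30:06Z), LH1-p02 (g2).

THE POINT.  ★ PART 2b `measure_box_partner_eq_of_image_eq` (`ArchStableOrbitalFamilyHJunction` §3) says: in one compatible frame ((C_H)+(C′G)), for a `G`-regular `γ_H`, a
norm partner `γ′` and sets `B ⊆ Z(γ_H)`, `B′ ⊆ Z(γ′)` with `(e ∘ ι) '' B = B′` — `ι = ι_∞|_{Z(γ_H)}` (★ `endoEmbArchCentralizer`), `e` the stable centraliser transport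
★ `archStableCentralizerEquiv` — one has `t′(γ′)(B′) = t_H(γ_H)(B)`.  The two (CUR-chart) junctions (★ `classOrbitalIntegral_mul_measure_box_eq_chartOrbG`, ★ `…_chartOrbH`)
read their scalars on the BOX IMAGES ★ `chartBoxImgG L α S ⊆ T_S′ = Z(gprimeTorus α S (ρ•c))` and ★ `chartBoxImg L S ⊆ T_S = Z(endoTorus S c)` of the SAME coordinate box
★ `chartBox L S`.  This file supplies the missing hypothesis: **`(e ∘ ι)` carries the `H`-box onto the `G′`-box** (§5), because `e ∘ ι` IS «same eigenvalue coordinates»: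
**`(e ∘ ι)(endoTorus S c₀) = gprimeTorus α S (slotPerm ρ c₀)` for EVERY `c₀`** (§4).  The mechanism (§2–§3): the place-wise conjugators between the two atlas charts used by
★ `isArchNormPair_endoTorus_gprimeTorus` (Cayley frame `ι(P,1)`, the permutation matrices of ★ `monomial_conj_circleDiagonal`, the boost eigenframe ★ `cayB` of
★ `boostStd_eq_conj_diagonal`) are INDEPENDENT OF THE COORDINATES, so one element `y ∈ GL₃(L ⊗ ℝ)` conjugates the whole `H`-chart onto the whole `G′`-chart
(`y · ι_∞(endoTorus S c₀) · y⁻¹ = gprimeTorus α S (ρ•c₀)` for all `c₀`), and ★ `coe_archStableCentralizerEquiv_eq_of_conj_eq` says `e` is conjugation by ANY such `y`.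
Finally (§1) the relabelling `slotPerm ρ` (`ρ_w = 1` on `S`, ★ `partnerPerms`) maps the box onto itself (it only permutes the three angle slots `[0, 2π]` at the compact places),
and (§6) the two junction scalars are EQUAL: `(t′(γ′) carried to T_S′)(B′_S) = (t_H(γ_H) carried to T_S)(B_S)` — the (READ) step has no free scalar.

* §1 `slotPerm_mem_chartBox_iff`, `slotPerm_inv_slotPerm`, `image_slotPerm_chartBox` (box stability under partner relabellings).
* §2 (one complex place, `GL₃(ℂ)`, namespace `…Automorphic.UnitaryGroup`) `endoGL_cayley_conj_eq`, **`exists_forall_conj_endoGL_endoBlock_eq_gprimeCptGL`** (compact place, every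
  relabelling), **`exists_forall_conj_endoGL_endoBlock_eq_gprimeSplitGL`** (split place) — explicit, coordinate-free conjugators.
* §3 **`exists_forall_conj_endoEmbArch_endoTorus_eq_gprimeTorus`** (`∃ y ∈ GL₃(L ⊗ ℝ), ∀ c, y ι_∞(endoTorus S c) y⁻¹ = gprimeTorus α S (ρ•c)`, ★ `GLnMixedPiEquiv`).
* §4 **`archStableCentralizerEquiv_endoEmbArchCentralizer_endoTorus`** (the transport on chart points is the relabelled `G′`-chart).
* §5 **`image_comp_preimage_chartBoxImg_eq`** — the (PARTNER) box hypothesis `hBB'` of ★ PART 2b, PROVED.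
* §6 **`map_subgroupCongr_symm_chartBoxImgG_eq`** — `(t′(γ′)).map (T_S′ ≅ Z(γ′))⁻¹ (B′_S) = (t_H(γ_H)).map (T_S ≅ Z(γ_H))⁻¹ (B_S)` under (C_H)+(C′G).
HONEST LABEL: HC_CM is proved only modulo the 7 printed citations (2 remaining: hLiu418 = `stmt-HodgeConjecture-24832`, h413 = `stmt-HodgeConjecture-24833`) until rung 0 closes;
count-neutral plumbing for the skeleton's (READ) step (no orbital integral, no transfer factor, no statement of `stub_N9` is touched).

## References
* [Rogawski1990] J. D. Rogawski, *Automorphic Representations of Unitary Groups in Three Variables*, Ann. of Math. Stud. 123 (1990), §1.7 p. 6, §3.1 p. 19, §3.6 p. 31, §4.3 (4.3.1)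
  pp. 43–44, §4.8 p. 53, §8.2 p. 122, §14.3 pp. 233–234.
* [Shelstad1979] D. Shelstad, *Characters and inner forms of a quasi-split group over ℝ*, Compositio Math. 39 (1979), §4 pp. 20–25, Lemma 4.2 p. 23.
* [LanglandsShelstad1987] R. P. Langlands, D. Shelstad, *On the definition of transfer factors*, Math. Ann. 278 (1987), §1.3–1.4.
* [Knapp1986] A. W. Knapp, *Representation Theory of Semisimple Groups* (1986), Ch. V §3.
* [BrockerTomDieck1985] Th. Bröcker, T. tom Dieck, *Representations of Compact Lie Groups*, GTM 98 (1985), IV (3.2).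
-/

set_option autoImplicit false

noncomputable section

open MeasureTheory MeasureTheory.Measure NumberField NumberField.InfinitePlace Matrix Complex Topology Equiv
open Literature.MeasureTheory.Group
open scoped MatrixGroups Matrix Classical NNReal ENNReal ComplexConjugate

/-! ## §1 The coordinate box is stable under the partner relabellings -/

namespace Literature.NumberTheory.Rogawski1990

open Literature.NumberTheory.Automorphic Literature.NumberTheory.Automorphic.UnitaryGroup Literature.NumberTheory.Automorphic.ArchCartan

section Box

variable (L : Type) [Field L] {S : Finset {w : InfinitePlace L // IsComplex w}} {ρ : {w : InfinitePlace L // IsComplex w} → Perm (Fin 3)}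

/-- **`slotPerm ρ c ∈ chartBox S ↔ c ∈ chartBox S`** for a relabelling with `ρ_w = 1` on `S`: at `w ∈ S` nothing moves, at `w ∉ S` the three slots all range over `[0, 2π]`.
[cite: Shelstad1979, Lemma 4.2 (p. 23)] [cite: Rogawski1990, §8.2 p. 122] -/
theorem slotPerm_mem_chartBox_iff (hρ : ∀ w ∈ S, ρ w = 1) (c : {w : InfinitePlace L // IsComplex w} → Fin 3 → ℝ) :
    slotPerm ρ c ∈ chartBox L S ↔ c ∈ chartBox L S := by
  simp only [chartBox, Set.mem_univ_pi, slotPerm_apply]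
  refine ⟨fun h w i => ?_, fun h w i => ?_⟩
  · by_cases hw : w ∈ S
    · have h1 := h w i
      rwa [hρ w hw, Equiv.Perm.coe_one, id] at h1
    · have h1 := h w ((ρ w).symm i)
      rw [Equiv.apply_symm_apply] at h1
      simp only [hw, false_and, if_false] at h1 ⊢
      exact h1
  · by_cases hw : w ∈ S
    · rw [hρ w hw, Equiv.Perm.coe_one, id]
      exact h w i
    · have h1 := h w (ρ w i)
      simp only [hw, false_and, if_false] at h1 ⊢
      exact h1

/-- `slotPerm ρ⁻¹ (slotPerm ρ c) = c` (the relabellings form a right action, ★ `slotPerm_mul`). [cite: Shelstad1979, Lemma 4.2 (p. 23)] -/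
theorem slotPerm_inv_slotPerm (ρ : {w : InfinitePlace L // IsComplex w} → Perm (Fin 3)) (c : {w : InfinitePlace L // IsComplex w} → Fin 3 → ℝ) :
    slotPerm ρ⁻¹ (slotPerm ρ c) = c := by
  funext w i
  simp only [slotPerm_apply, Pi.inv_apply, Equiv.Perm.inv_def, Equiv.apply_symm_apply]

/-- `slotPerm ρ (slotPerm ρ⁻¹ c) = c`. [cite: Shelstad1979, Lemma 4.2 (p. 23)] -/
theorem slotPerm_slotPerm_inv (ρ : {w : InfinitePlace L // IsComplex w} → Perm (Fin 3)) (c : {w : InfinitePlace L // IsComplex w} → Fin 3 → ℝ) :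
    slotPerm ρ (slotPerm ρ⁻¹ c) = c := by
  funext w i
  simp only [slotPerm_apply, Pi.inv_apply, Equiv.Perm.inv_def, Equiv.symm_apply_apply]

/-- **The box is carried onto itself by a partner relabelling**: `slotPerm ρ '' chartBox S = chartBox S` (`ρ_w = 1` on `S`). [cite: Shelstad1979, Lemma 4.2 (p. 23)] [cite: Rogawski1990, §8.2 p. 122] -/
theorem image_slotPerm_chartBox (hρ : ∀ w ∈ S, ρ w = 1) : slotPerm ρ '' chartBox L S = chartBox L S := by
  have hρ' : ∀ w ∈ S, ρ⁻¹ w = 1 := fun w hw => by rw [Pi.inv_apply, hρ w hw, inv_one]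
  ext c
  constructor
  · rintro ⟨c', hc', rfl⟩
    exact (slotPerm_mem_chartBox_iff L hρ c').2 hc'
  · intro hc
    exact ⟨slotPerm ρ⁻¹ c, (slotPerm_mem_chartBox_iff L hρ' c).2 hc, slotPerm_slotPerm_inv L ρ c⟩

end Box

end Literature.NumberTheory.Rogawski1990

/-! ## §2 One complex place: the two atlas charts are conjugate by COORDINATE-FREE matrices -/

namespace Literature.NumberTheory.Automorphic.UnitaryGroup

open Literature.NumberTheory.Rogawski1990 Literature.LinearAlgebra.Matrix

section Local

variable (L : Type) [Field L] [NumberField L] [IsCMField L] (α : Fin 3 → L) {S : Finset {w : InfinitePlace L // IsComplex w}}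
  {w : {w : InfinitePlace L // IsComplex w}}

omit [NumberField L] [IsCMField L] in
/-- **The Cayley frame, as an EQUATION**: `ι(P·diag(a,b)·P⁻¹, (u)) = ι(P, 1) · diag(a, u, b) · ι(P, 1)⁻¹` in `GL₃(ℂ)` (★ `endoGL` is a homomorphism, ★ `endoGL_circleDiagonal`) —
the conjugator `ι(P, 1)` does not depend on `(a, b, u)`. [cite: Rogawski1990, §8.2 p. 122; §4.8 p. 53] -/
theorem endoGL_cayley_conj_eq (a b u : Circle) :
    endoGL (Matrix.GeneralLinearGroup.mkOfDetNeZero !![(1 : ℂ), 1; 1, -1] det_cayleyTwo_ne_zero * circleDiagonal 2 ![a, b] *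
        (Matrix.GeneralLinearGroup.mkOfDetNeZero !![(1 : ℂ), 1; 1, -1] det_cayleyTwo_ne_zero)⁻¹, circleDiagonal 1 ![u]) =
      endoGL (Matrix.GeneralLinearGroup.mkOfDetNeZero !![(1 : ℂ), 1; 1, -1] det_cayleyTwo_ne_zero, (1 : GL (Fin 1) ℂ)) * circleDiagonal 3 ![a, u, b] *
        (endoGL (Matrix.GeneralLinearGroup.mkOfDetNeZero !![(1 : ℂ), 1; 1, -1] det_cayleyTwo_ne_zero, (1 : GL (Fin 1) ℂ)))⁻¹ := by
  rw [← endoGL_circleDiagonal]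
  have hprod : (Matrix.GeneralLinearGroup.mkOfDetNeZero !![(1 : ℂ), 1; 1, -1] det_cayleyTwo_ne_zero * circleDiagonal 2 ![a, b] *
        (Matrix.GeneralLinearGroup.mkOfDetNeZero !![(1 : ℂ), 1; 1, -1] det_cayleyTwo_ne_zero)⁻¹, circleDiagonal 1 ![u]) =
      (Matrix.GeneralLinearGroup.mkOfDetNeZero !![(1 : ℂ), 1; 1, -1] det_cayleyTwo_ne_zero, (1 : GL (Fin 1) ℂ)) *
        (circleDiagonal 2 ![a, b], circleDiagonal 1 ![u]) *
        (Matrix.GeneralLinearGroup.mkOfDetNeZero !![(1 : ℂ), 1; 1, -1] det_cayleyTwo_ne_zero, (1 : GL (Fin 1) ℂ))⁻¹ := by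
    simp only [Prod.mk_mul_mk, Prod.inv_mk, one_mul, inv_one, mul_one]
  rw [hprod, map_mul, map_mul, map_inv]

omit [NumberField L] [IsCMField L] in
/-- **COMPACT PLACE, SIMULTANEOUS CONJUGATION**: at `w ∉ S` there is ONE `u ∈ GL₃(ℂ)` with `u · ι(endoBlock S c w, endoCircle c w) · u⁻¹ = gprimeCptGL τ (c_w ∘ ρ_w)` for EVERY
coordinate `c` (`u` = permutation matrix of `(τ⁻¹·ρ_w)⁻¹` times `ι(P, 1)⁻¹`; ★ `coe_endoBlock_eq_cayley_of_not_mem`, ★ `monomial_conj_circleDiagonal`).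
[cite: Rogawski1990, §8.2 p. 122; §3.1 p. 19] [cite: BrockerTomDieck1985, IV (3.2)] -/
theorem exists_forall_conj_endoGL_endoBlock_eq_gprimeCptGL (hw : w ∉ S) (τ ρw : Perm (Fin 3)) :
    ∃ u : GL (Fin 3) ℂ, ∀ c : {w : InfinitePlace L // IsComplex w} → Fin 3 → ℝ,
      u * endoGL (((endoBlock L S c w : ↥(archLocal L 2 (Matrix.of fun i j : Fin 2 => if i.val + j.val + 1 = 2 then (1 : L) else 0) w)) : GL (Fin 2) ℂ),
            ((endoCircle L c w : ↥(archLocal L 1 (Matrix.of fun i j : Fin 1 => if i.val + j.val + 1 = 1 then (1 : L) else 0) w)) : GL (Fin 1) ℂ)) * u⁻¹ =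
        gprimeCptGL τ (c w ∘ ⇑ρw) := by
  refine ⟨Matrix.GeneralLinearGroup.mkOfDetNeZero _ (det_monomial_one_ne_zero 3 (τ.symm.trans ρw).symm) *
      (endoGL (Matrix.GeneralLinearGroup.mkOfDetNeZero !![(1 : ℂ), 1; 1, -1] det_cayleyTwo_ne_zero, (1 : GL (Fin 1) ℂ)))⁻¹, fun c => ?_⟩
  rw [coe_endoBlock_eq_cayley_of_not_mem (L := L) (S := S) (c := c) (w := w) hw]
  -- `ι(endoCircle) = circleDiagonal 1 ![e^{ic₁}]` definitionally; undo the Cayley frame by `ι(P,1)⁻¹`, then relabel by the permutation matrix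
  have hE : endoGL (Matrix.GeneralLinearGroup.mkOfDetNeZero !![(1 : ℂ), 1; 1, -1] det_cayleyTwo_ne_zero * circleDiagonal 2 ![Circle.exp (c w 0), Circle.exp (c w 2)] *
        (Matrix.GeneralLinearGroup.mkOfDetNeZero !![(1 : ℂ), 1; 1, -1] det_cayleyTwo_ne_zero)⁻¹,
        ((endoCircle L c w : ↥(archLocal L 1 (Matrix.of fun i j : Fin 1 => if i.val + j.val + 1 = 1 then (1 : L) else 0) w)) : GL (Fin 1) ℂ)) =
      endoGL (Matrix.GeneralLinearGroup.mkOfDetNeZero !![(1 : ℂ), 1; 1, -1] det_cayleyTwo_ne_zero, (1 : GL (Fin 1) ℂ)) *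
        circleDiagonal 3 ![Circle.exp (c w 0), Circle.exp (c w 1), Circle.exp (c w 2)] *
        (endoGL (Matrix.GeneralLinearGroup.mkOfDetNeZero !![(1 : ℂ), 1; 1, -1] det_cayleyTwo_ne_zero, (1 : GL (Fin 1) ℂ)))⁻¹ :=
    endoGL_cayley_conj_eq (Circle.exp (c w 0)) (Circle.exp (c w 2)) (Circle.exp (c w 1))
  have hperm := monomial_conj_circleDiagonal 3 (τ.symm.trans ρw).symm ![Circle.exp (c w 0), Circle.exp (c w 1), Circle.exp (c w 2)]
  have hcpt : gprimeCptGL τ (c w ∘ ⇑ρw) = circleDiagonal 3 (fun i => (![Circle.exp (c w 0), Circle.exp (c w 1), Circle.exp (c w 2)] : Fin 3 → Circle) ((τ.symm.trans ρw).symm.symm i)) := by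
    unfold gprimeCptGL
    congr 1
    funext ℓ
    simp only [Equiv.symm_symm, Equiv.trans_apply, Function.comp_apply]
    generalize ρw (τ.symm ℓ) = k
    fin_cases k <;> rfl
  rw [hE, hcpt, ← hperm]
  group

omit [NumberField L] [IsCMField L] in
/-- **SPLIT PLACE, SIMULTANEOUS CONJUGATION**: at `w ∈ S ∩ splitChartPlaces` there is ONE `u ∈ GL₃(ℂ)` with `u · ι(endoBlock S c w, endoCircle c w) · u⁻¹ = gprimeBlock α w S c`
for EVERY `c` (`ι(hypBlock, circle) = diag(boostEig (c w))` literally, ★ `coe_endoGL_hypBlockGL`; `u` = permutation matrix of `τ = lineOf s` times the boost eigenframe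
★ `cayB (a∘τ)`, which is «independent of `c`», ★ `boostStd_eq_conj_diagonal`). [cite: Knapp1986, Ch. V §3] [cite: Rogawski1990, §3.6 p. 31] -/
theorem exists_forall_conj_endoGL_endoBlock_eq_gprimeBlock_of_mem (hw : w ∈ S) (hsp : w ∈ splitChartPlaces L α) :
    ∃ u : GL (Fin 3) ℂ, ∀ c : {w : InfinitePlace L // IsComplex w} → Fin 3 → ℝ,
      u * endoGL (((endoBlock L S c w : ↥(archLocal L 2 (Matrix.of fun i j : Fin 2 => if i.val + j.val + 1 = 2 then (1 : L) else 0) w)) : GL (Fin 2) ℂ),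
            ((endoCircle L c w : ↥(archLocal L 1 (Matrix.of fun i j : Fin 1 => if i.val + j.val + 1 = 1 then (1 : L) else 0) w)) : GL (Fin 1) ℂ)) * u⁻¹ =
        ((gprimeBlock L α w S c : ↥(archLocal L 3 (Matrix.diagonal α) w)) : GL (Fin 3) ℂ) := by
  set τ : Perm (Fin 3) := lineOf (formSign L α w) with hτ
  set a : Fin 3 → ℝ := formRe L α w with ha
  have hb : (a ∘ ⇑τ) 0 * (a ∘ ⇑τ) 2 < 0 := hsp.2
  refine ⟨Matrix.GeneralLinearGroup.mkOfDetNeZero _ (det_monomial_one_ne_zero 3 τ) * Matrix.GeneralLinearGroup.mkOfDetNeZero _ (det_cayB_ne_zero hb), fun c => ?_⟩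
  rw [coe_gprimeBlock_of_mem (L := L) (α := α) (S' := S) (c := c) (w := w) hw hsp,
    coe_endoBlock_eq_hypBlockGL_of_mem (L := L) (S := S) (c := c) (w := w) hw]
  have hD : endoGL (hypBlockGL (c w 0) (c w 2), ((endoCircle L c w : ↥(archLocal L 1 (Matrix.of fun i j : Fin 1 => if i.val + j.val + 1 = 1 then (1 : L) else 0) w)) : GL (Fin 1) ℂ)) =
      Matrix.GeneralLinearGroup.mkOfDetNeZero (Matrix.diagonal (boostEig (c w))) (det_diagonal_boostEig_ne_zero (c w)) := by
    apply Units.ext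
    rw [Matrix.GeneralLinearGroup.val_mkOfDetNeZero]
    exact coe_endoGL_hypBlockGL (c w)
  rw [hD, mul_inv_eq_iff_eq_mul]
  apply Units.ext
  rw [Units.val_mul, Units.val_mul, Units.val_mul, Matrix.GeneralLinearGroup.val_mkOfDetNeZero, Matrix.GeneralLinearGroup.val_mkOfDetNeZero,
    Matrix.GeneralLinearGroup.val_mkOfDetNeZero, coe_gprimeSplitGL]
  -- `M(τ) · cayB · D = M(τ) · boostStd · cayB = boostStd.submatrix τ⁻¹ τ⁻¹ · M(τ) · cayB`
  unfold gprimeSplitMatrix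
  rw [Matrix.mul_assoc _ (cayB (a ∘ ⇑τ)), ← boostStd_mul_cayB hb (c w), ← Matrix.mul_assoc, monomial_one_mul_eq_submatrix_mul τ, Matrix.mul_assoc,
    Units.val_mul, Matrix.GeneralLinearGroup.val_mkOfDetNeZero, Matrix.GeneralLinearGroup.val_mkOfDetNeZero]

end Local

/-! ## §3 `L ⊗ ℝ`: one element of `GL₃(L ⊗ ℝ)` conjugates the whole `H`-chart onto the whole `G′`-chart -/

section Global

variable (L : Type) [Field L] [NumberField L] [IsCMField L] (α : Fin 3 → L) (S : Finset {w : InfinitePlace L // IsComplex w})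

/-- **SIMULTANEOUS CONJUGATION IN `GL₃(L ⊗ ℝ)`**: for a Cartan class `S ⊆ splitChartPlaces` and a relabelling `ρ` with `ρ_w = 1` on `S` there is ONE `y ∈ GL₃(L ⊗ ℝ)` with
`y · ι_∞(endoTorus S c) · y⁻¹ = gprimeTorus α S (slotPerm ρ c)` for EVERY `c` (assemble the place-wise conjugators of §2 through ★ `GLnMixedPiEquiv`; this refines ★
`isArchNormPair_endoTorus_gprimeTorus`, whose conjugator was allowed to depend on `c`). [cite: Rogawski1990, §3.1 p. 19; §4.3 pp. 43–44; §8.2 p. 122] [cite: Shelstad1979, §4 p. 22] -/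
theorem exists_forall_conj_endoEmbArch_endoTorus_eq_gprimeTorus (hS : ∀ w ∈ S, w ∈ splitChartPlaces L α)
    (ρ : {w : InfinitePlace L // IsComplex w} → Perm (Fin 3)) (hρ : ∀ w ∈ S, ρ w = 1) :
    ∃ y : GL (Fin 3) (mixedEmbedding.mixedSpace L), ∀ c : {w : InfinitePlace L // IsComplex w} → Fin 3 → ℝ,
      y * ((endoEmbArch L (endoTorus L S c)).val : GL (Fin 3) (mixedEmbedding.mixedSpace L)) * y⁻¹ =
        ((gprimeTorus L α S (slotPerm ρ c) : ↥(arch (↥(maximalRealSubfield L)) L (IsCMField.complexConj L) 3 (Matrix.diagonal α))) :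
          GL (Fin 3) (mixedEmbedding.mixedSpace L)) := by
  -- place-wise conjugators, uniform in `c`
  have hplace : ∀ w : {w : InfinitePlace L // IsComplex w}, ∃ u : GL (Fin 3) ℂ, ∀ c : {w : InfinitePlace L // IsComplex w} → Fin 3 → ℝ,
      u * endoGL (((endoBlock L S c w : ↥(archLocal L 2 (Matrix.of fun i j : Fin 2 => if i.val + j.val + 1 = 2 then (1 : L) else 0) w)) : GL (Fin 2) ℂ),
            ((endoCircle L c w : ↥(archLocal L 1 (Matrix.of fun i j : Fin 1 => if i.val + j.val + 1 = 1 then (1 : L) else 0) w)) : GL (Fin 1) ℂ)) * u⁻¹ =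
        ((gprimeBlock L α w S (slotPerm ρ c) : ↥(archLocal L 3 (Matrix.diagonal α) w)) : GL (Fin 3) ℂ) := by
    intro w
    by_cases hw : w ∈ S
    · obtain ⟨u, hu⟩ := exists_forall_conj_endoGL_endoBlock_eq_gprimeBlock_of_mem L α hw (hS w hw)
      refine ⟨u, fun c => ?_⟩
      rw [hu c]
      have hc : slotPerm ρ c w = c w := slotPerm_apply_of_eq_one (hρ w hw) c
      unfold gprimeBlock
      simp only [hc]
    · obtain ⟨u, hu⟩ := exists_forall_conj_endoGL_endoBlock_eq_gprimeCptGL L (S := S) hw (lineOf (formSign L α w)) (ρ w)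
      refine ⟨u, fun c => ?_⟩
      rw [hu c, coe_gprimeBlock_of_not_mem L α _ hw]
      rfl
  choose u hu using hplace
  refine ⟨(GLnMixedPiEquiv (↥(maximalRealSubfield L)) L (IsCMField.complexConj L) 3 (IsCMField.complexConj_ne_one L) (complexConj_smul_infinitePlace L)).symm u,
    fun c => ?_⟩
  apply (GLnMixedPiEquiv (↥(maximalRealSubfield L)) L (IsCMField.complexConj L) 3 (IsCMField.complexConj_ne_one L) (complexConj_smul_infinitePlace L)).injective
  rw [map_mul, map_mul, map_inv, ContinuousMulEquiv.apply_symm_apply]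
  funext w
  rw [Pi.mul_apply, Pi.mul_apply, Pi.inv_apply, GLnMixedPiEquiv_apply, GLnMixedPiEquiv_apply, map_evalC_endoEmbArch_endoTorus L S c w, map_evalC_gprimeTorus L α S _ w]
  exact hu w c

end Global

end Literature.NumberTheory.Automorphic.UnitaryGroup

/-! ## §4 The stable centraliser transport on chart points: «same eigenvalue coordinates» -/

namespace Literature.NumberTheory.Rogawski1990

open Literature.NumberTheory.Automorphic Literature.NumberTheory.Automorphic.UnitaryGroup Literature.NumberTheory.Automorphic.ArchCartan

section Transport

variable (L : Type) [Field L] [NumberField L] [IsCMField L] (α : Fin 3 → L) (S : Finset {w : InfinitePlace L // IsComplex w})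
  (hd' : (Matrix.diagonal α).det ≠ 0)
  (hd₃ : ((Matrix.of fun i j : Fin 3 => if i.val + j.val + 1 = 3 then (1 : L) else 0) : Matrix (Fin 3) (Fin 3) L).det ≠ 0)
  {c : {w : InfinitePlace L // IsComplex w} → Fin 3 → ℝ} {ρ : {w : InfinitePlace L // IsComplex w} → Perm (Fin 3)}
  (hS : ∀ w ∈ S, w ∈ splitChartPlaces L α) (hρ : ∀ w ∈ S, ρ w = 1)
  (hreg : IsArchGRegular L (endoTorus L S c))
  (hnp : IsArchNormPair L (Matrix.diagonal α) (endoTorus L S c) (gprimeTorus L α S (slotPerm ρ c)))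

include hS hρ in
/-- **THE TRANSPORT ON CHART POINTS IS THE RELABELLED `G′`-CHART**: for a `G`-regular chart point `γ_H = endoTorus S c` and its norm partner `γ′ = gprimeTorus α S (ρ•c)`, the stable
centraliser transport `e = archStableCentralizerEquiv` composed with `ι = ι_∞|_{Z(γ_H)}` sends the chart point `endoTorus S c₀ ∈ Z(γ_H)` to `gprimeTorus α S (ρ•c₀) ∈ Z(γ′)` — for
EVERY `c₀` (★ `coe_archStableCentralizerEquiv_eq_of_conj_eq` with the coordinate-free conjugator of §3: `e` is «same eigenvalue coordinates»).
[cite: Rogawski1990, §4.3 pp. 43–44; §8.2 p. 122] [cite: Shelstad1979, §4 p. 20; Lemma 4.2 p. 23] [cite: LanglandsShelstad1987, §1.3–1.4] -/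
theorem archStableCentralizerEquiv_endoEmbArchCentralizer_endoTorus (c₀ : {w : InfinitePlace L // IsComplex w} → Fin 3 → ℝ) :
    archStableCentralizerEquiv L hd₃ hd' (hnp.corresponds_endoEmbArch L (Matrix.diagonal α)) (hreg.isRegularElt_endoEmbArch L)
        (endoEmbArchCentralizer L (endoTorus L S c) ⟨endoTorus L S c₀, chartTorusH_le_centralizer L S c (endoTorus_mem_chartTorusH L S c₀)⟩) =
      ⟨gprimeTorus L α S (slotPerm ρ c₀), chartTorusG_le_centralizer L α S (slotPerm ρ c) (gprimeTorus_mem_chartTorusG L α S (slotPerm ρ c₀))⟩ := by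
  obtain ⟨y, hy⟩ := exists_forall_conj_endoEmbArch_endoTorus_eq_gprimeTorus L α S hS ρ hρ
  apply Subtype.ext
  apply Subtype.ext
  rw [coe_archStableCentralizerEquiv_eq_of_conj_eq L hd₃ hd' (hnp.corresponds_endoEmbArch L (Matrix.diagonal α)) (hreg.isRegularElt_endoEmbArch L) y (hy c)]
  exact hy c₀

include hS hρ in
/-- The same, for an arbitrary element of `Z(γ_H)` lying on the chart: `↑z = endoTorus S c₀ ⇒ ↑(e (ι z)) = gprimeTorus α S (ρ•c₀)`.
[cite: Rogawski1990, §4.3 pp. 43–44] [cite: Shelstad1979, Lemma 4.2 p. 23] -/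
theorem coe_archStableCentralizerEquiv_endoEmbArchCentralizer_of_coe_eq
    (z : Subgroup.centralizer ({endoTorus L S c} : Set (↥(arch (↥(maximalRealSubfield L)) L (IsCMField.complexConj L) 2 (Matrix.of fun i j : Fin 2 => if i.val + j.val + 1 = 2 then (1 : L) else 0)) × ↥(arch (↥(maximalRealSubfield L)) L (IsCMField.complexConj L) 1 (Matrix.of fun i j : Fin 1 => if i.val + j.val + 1 = 1 then (1 : L) else 0)))))
    {c₀ : {w : InfinitePlace L // IsComplex w} → Fin 3 → ℝ}
    (hz : (z : ↥(arch (↥(maximalRealSubfield L)) L (IsCMField.complexConj L) 2 (Matrix.of fun i j : Fin 2 => if i.val + j.val + 1 = 2 then (1 : L) else 0)) × ↥(arch (↥(maximalRealSubfield L)) L (IsCMField.complexConj L) 1 (Matrix.of fun i j : Fin 1 => if i.val + j.val + 1 = 1 then (1 : L) else 0))) = endoTorus L S c₀) :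
    ((archStableCentralizerEquiv L hd₃ hd' (hnp.corresponds_endoEmbArch L (Matrix.diagonal α)) (hreg.isRegularElt_endoEmbArch L) (endoEmbArchCentralizer L (endoTorus L S c) z) :
        ↥(arch (↥(maximalRealSubfield L)) L (IsCMField.complexConj L) 3 (Matrix.diagonal α)))) = gprimeTorus L α S (slotPerm ρ c₀) := by
  have hz' : z = ⟨endoTorus L S c₀, chartTorusH_le_centralizer L S c (endoTorus_mem_chartTorusH L S c₀)⟩ := Subtype.ext hz
  rw [hz', archStableCentralizerEquiv_endoEmbArchCentralizer_endoTorus L α S hd' hd₃ hS hρ hreg hnp c₀]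

/-! ## §5 BOX COHERENCE: `(e ∘ ι)` carries the `H`-box onto the `G′`-box -/

/-- The `H`-box read inside `Z(γ_H)` through a presentation `T_S = Z(γ_H)`: the pre-image of ★ `chartBoxImg L S` is `{z | ↑z = endoTorus S c₀, c₀ ∈ chartBox S}`.
[cite: Rogawski1990, §8.2 p. 122] -/
theorem mem_preimage_subgroupCongr_symm_chartBoxImg_iff
    (hT : chartTorusH L S = Subgroup.centralizer ({endoTorus L S c} : Set (↥(arch (↥(maximalRealSubfield L)) L (IsCMField.complexConj L) 2 (Matrix.of fun i j : Fin 2 => if i.val + j.val + 1 = 2 then (1 : L) else 0)) × ↥(arch (↥(maximalRealSubfield L)) L (IsCMField.complexConj L) 1 (Matrix.of fun i j : Fin 1 => if i.val + j.val + 1 = 1 then (1 : L) else 0)))))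
    (z : Subgroup.centralizer ({endoTorus L S c} : Set (↥(arch (↥(maximalRealSubfield L)) L (IsCMField.complexConj L) 2 (Matrix.of fun i j : Fin 2 => if i.val + j.val + 1 = 2 then (1 : L) else 0)) × ↥(arch (↥(maximalRealSubfield L)) L (IsCMField.complexConj L) 1 (Matrix.of fun i j : Fin 1 => if i.val + j.val + 1 = 1 then (1 : L) else 0))))) :
    z ∈ ⇑(MulEquiv.subgroupCongr hT).symm ⁻¹' chartBoxImg L S ↔
      ∃ c₀ ∈ chartBox L S, (z : ↥(arch (↥(maximalRealSubfield L)) L (IsCMField.complexConj L) 2 (Matrix.of fun i j : Fin 2 => if i.val + j.val + 1 = 2 then (1 : L) else 0)) × ↥(arch (↥(maximalRealSubfield L)) L (IsCMField.complexConj L) 1 (Matrix.of fun i j : Fin 1 => if i.val + j.val + 1 = 1 then (1 : L) else 0))) = endoTorus L S c₀ := by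
  simp only [Set.mem_preimage, chartBoxImg, Set.mem_image]
  constructor
  · rintro ⟨c₀, hc₀, h⟩
    exact ⟨c₀, hc₀, (congrArg Subtype.val h).symm⟩
  · rintro ⟨c₀, hc₀, h⟩
    exact ⟨c₀, hc₀, Subtype.ext h.symm⟩

/-- The `G′`-box read inside `Z(γ′)` through `T_S′ = Z(γ′)`: the pre-image of ★ `chartBoxImgG L α S` is `{z′ | ↑z′ = gprimeTorus α S c₁, c₁ ∈ chartBox S}`.
[cite: Rogawski1990, §8.2 p. 122] -/
theorem mem_preimage_subgroupCongr_symm_chartBoxImgG_iff {c' : {w : InfinitePlace L // IsComplex w} → Fin 3 → ℝ}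
    (hT' : chartTorusG L α S = Subgroup.centralizer ({gprimeTorus L α S c'} : Set ↥(arch (↥(maximalRealSubfield L)) L (IsCMField.complexConj L) 3 (Matrix.diagonal α))))
    (z' : Subgroup.centralizer ({gprimeTorus L α S c'} : Set ↥(arch (↥(maximalRealSubfield L)) L (IsCMField.complexConj L) 3 (Matrix.diagonal α)))) :
    z' ∈ ⇑(MulEquiv.subgroupCongr hT').symm ⁻¹' chartBoxImgG L α S ↔
      ∃ c₁ ∈ chartBox L S, (z' : ↥(arch (↥(maximalRealSubfield L)) L (IsCMField.complexConj L) 3 (Matrix.diagonal α))) = gprimeTorus L α S c₁ := by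
  simp only [Set.mem_preimage, chartBoxImgG, Set.mem_image]
  constructor
  · rintro ⟨c₁, hc₁, h⟩
    exact ⟨c₁, hc₁, (congrArg Subtype.val h).symm⟩
  · rintro ⟨c₁, hc₁, h⟩
    exact ⟨c₁, hc₁, Subtype.ext h.symm⟩

include hS hρ in
/-- **BOX COHERENCE — the (PARTNER) hypothesis `hBB'` of ★ `measure_box_partner_eq_of_image_eq`, PROVED**: through the presentations `T_S = Z(endoTorus S c)` and
`T_S′ = Z(gprimeTorus α S (ρ•c))`, the composite `e ∘ ι` carries the `H`-box `B_S` onto the `G′`-box `B′_S` (§4 + the box is stable under `slotPerm ρ`, §1).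
[cite: Rogawski1990, §4.3 (4.3.1) p. 43; §8.2 p. 122] [cite: Shelstad1979, §4 p. 20; Lemma 4.2 p. 23] [cite: LanglandsShelstad1987, §1.3–1.4] -/
theorem image_comp_preimage_chartBoxImg_eq
    (hT : chartTorusH L S = Subgroup.centralizer ({endoTorus L S c} : Set (↥(arch (↥(maximalRealSubfield L)) L (IsCMField.complexConj L) 2 (Matrix.of fun i j : Fin 2 => if i.val + j.val + 1 = 2 then (1 : L) else 0)) × ↥(arch (↥(maximalRealSubfield L)) L (IsCMField.complexConj L) 1 (Matrix.of fun i j : Fin 1 => if i.val + j.val + 1 = 1 then (1 : L) else 0)))))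
    (hT' : chartTorusG L α S = Subgroup.centralizer ({gprimeTorus L α S (slotPerm ρ c)} : Set ↥(arch (↥(maximalRealSubfield L)) L (IsCMField.complexConj L) 3 (Matrix.diagonal α)))) :
    (⇑(archStableCentralizerEquiv L hd₃ hd' (hnp.corresponds_endoEmbArch L (Matrix.diagonal α)) (hreg.isRegularElt_endoEmbArch L)) ∘
        ⇑(endoEmbArchCentralizer L (endoTorus L S c))) '' (⇑(MulEquiv.subgroupCongr hT).symm ⁻¹' chartBoxImg L S) =
      ⇑(MulEquiv.subgroupCongr hT').symm ⁻¹' chartBoxImgG L α S := by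
  have hρ' : ∀ w ∈ S, ρ⁻¹ w = 1 := fun w hw => by rw [Pi.inv_apply, hρ w hw, inv_one]
  ext z'
  rw [Set.mem_image, mem_preimage_subgroupCongr_symm_chartBoxImgG_iff L α S hT']
  constructor
  · rintro ⟨z, hz, rfl⟩
    obtain ⟨c₀, hc₀, hzc⟩ := (mem_preimage_subgroupCongr_symm_chartBoxImg_iff L S hT z).1 hz
    exact ⟨slotPerm ρ c₀, (slotPerm_mem_chartBox_iff L hρ c₀).2 hc₀,
      coe_archStableCentralizerEquiv_endoEmbArchCentralizer_of_coe_eq L α S hd' hd₃ hS hρ hreg hnp z hzc⟩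
  · rintro ⟨c₁, hc₁, hz'⟩
    refine ⟨⟨endoTorus L S (slotPerm ρ⁻¹ c₁), chartTorusH_le_centralizer L S c (endoTorus_mem_chartTorusH L S (slotPerm ρ⁻¹ c₁))⟩,
      (mem_preimage_subgroupCongr_symm_chartBoxImg_iff L S hT _).2 ⟨slotPerm ρ⁻¹ c₁, (slotPerm_mem_chartBox_iff L hρ' c₁).2 hc₁, rfl⟩, ?_⟩
    apply Subtype.ext
    rw [Function.comp_apply, archStableCentralizerEquiv_endoEmbArchCentralizer_endoTorus L α S hd' hd₃ hS hρ hreg hnp, slotPerm_slotPerm_inv, hz']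

end Transport

/-! ## §6 The two junction scalars of one packet coincide -/

section Scalars

variable (L : Type) [Field L] [NumberField L] [IsCMField L] (α : Fin 3 → L)
  [MeasurableSpace (↥(arch (↥(maximalRealSubfield L)) L (IsCMField.complexConj L) 3 (Matrix.diagonal α)))] [BorelSpace (↥(arch (↥(maximalRealSubfield L)) L (IsCMField.complexConj L) 3 (Matrix.diagonal α)))]
  [MeasurableSpace ↥(arch (↥(maximalRealSubfield L)) L (IsCMField.complexConj L) 3 (Matrix.of fun i j : Fin 3 => if i.val + j.val + 1 = 3 then (1 : L) else 0))] [BorelSpace ↥(arch (↥(maximalRealSubfield L)) L (IsCMField.complexConj L) 3 (Matrix.of fun i j : Fin 3 => if i.val + j.val + 1 = 3 then (1 : L) else 0))]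
  [MeasurableSpace (↥(arch (↥(maximalRealSubfield L)) L (IsCMField.complexConj L) 2 (Matrix.of fun i j : Fin 2 => if i.val + j.val + 1 = 2 then (1 : L) else 0)) × ↥(arch (↥(maximalRealSubfield L)) L (IsCMField.complexConj L) 1 (Matrix.of fun i j : Fin 1 => if i.val + j.val + 1 = 1 then (1 : L) else 0)))] [BorelSpace (↥(arch (↥(maximalRealSubfield L)) L (IsCMField.complexConj L) 2 (Matrix.of fun i j : Fin 2 => if i.val + j.val + 1 = 2 then (1 : L) else 0)) × ↥(arch (↥(maximalRealSubfield L)) L (IsCMField.complexConj L) 1 (Matrix.of fun i j : Fin 1 => if i.val + j.val + 1 = 1 then (1 : L) else 0)))]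
  (t' : ∀ γ' : ↥(arch (↥(maximalRealSubfield L)) L (IsCMField.complexConj L) 3 (Matrix.diagonal α)), Measure (Subgroup.centralizer ({γ'} : Set (↥(arch (↥(maximalRealSubfield L)) L (IsCMField.complexConj L) 3 (Matrix.diagonal α))))))
  (t : ∀ γ : ↥(arch (↥(maximalRealSubfield L)) L (IsCMField.complexConj L) 3 (Matrix.of fun i j : Fin 3 => if i.val + j.val + 1 = 3 then (1 : L) else 0)), Measure (Subgroup.centralizer ({γ} : Set ↥(arch (↥(maximalRealSubfield L)) L (IsCMField.complexConj L) 3 (Matrix.of fun i j : Fin 3 => if i.val + j.val + 1 = 3 then (1 : L) else 0)))))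
  (tH : ∀ γH : (↥(arch (↥(maximalRealSubfield L)) L (IsCMField.complexConj L) 2 (Matrix.of fun i j : Fin 2 => if i.val + j.val + 1 = 2 then (1 : L) else 0)) × ↥(arch (↥(maximalRealSubfield L)) L (IsCMField.complexConj L) 1 (Matrix.of fun i j : Fin 1 => if i.val + j.val + 1 = 1 then (1 : L) else 0))), Measure (Subgroup.centralizer ({γH} : Set (↥(arch (↥(maximalRealSubfield L)) L (IsCMField.complexConj L) 2 (Matrix.of fun i j : Fin 2 => if i.val + j.val + 1 = 2 then (1 : L) else 0)) × ↥(arch (↥(maximalRealSubfield L)) L (IsCMField.complexConj L) 1 (Matrix.of fun i j : Fin 1 => if i.val + j.val + 1 = 1 then (1 : L) else 0))))))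
  (hd' : (Matrix.diagonal α).det ≠ 0) (hd₃ : ((Matrix.of fun i j : Fin 3 => if i.val + j.val + 1 = 3 then (1 : L) else 0) : Matrix (Fin 3) (Fin 3) L).det ≠ 0)
  -- (C′G) of ★ `ArchCompatibleFamiliesG`
  (hC'G : ∀ (γ' : ↥(arch (↥(maximalRealSubfield L)) L (IsCMField.complexConj L) 3 (Matrix.diagonal α))) (γ : ↥(arch (↥(maximalRealSubfield L)) L (IsCMField.complexConj L) 3 (Matrix.of fun i j : Fin 3 => if i.val + j.val + 1 = 3 then (1 : L) else 0))) (h' : IsRegularElt (γ'.val : GL (Fin 3) (mixedEmbedding.mixedSpace L)))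
      (hc : Corresponds (UnitaryGroup.conjMixed (↥(maximalRealSubfield L)) L (IsCMField.complexConj L))
        (UnitaryGroup.archFormOf L 3 (Matrix.diagonal α)) (UnitaryGroup.archFormOf L 3 (Matrix.of fun i j : Fin 3 => if i.val + j.val + 1 = 3 then (1 : L) else 0)) γ' γ),
      Measure.map ⇑(UnitaryGroup.archStableCentralizerEquiv L hd' hd₃ hc h') (t' γ') = t γ)
  -- (C_H) of ★ `ArchCompatibleFamiliesH`
  (hCH : ∀ γH : (↥(arch (↥(maximalRealSubfield L)) L (IsCMField.complexConj L) 2 (Matrix.of fun i j : Fin 2 => if i.val + j.val + 1 = 2 then (1 : L) else 0)) × ↥(arch (↥(maximalRealSubfield L)) L (IsCMField.complexConj L) 1 (Matrix.of fun i j : Fin 1 => if i.val + j.val + 1 = 1 then (1 : L) else 0))), IsArchGRegular L γH → Measure.map ⇑(endoEmbArchCentralizer L γH) (tH γH) = t (endoEmbArch L γH))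
  {S : Finset {w : InfinitePlace L // IsComplex w}} {c : {w : InfinitePlace L // IsComplex w} → Fin 3 → ℝ} {ρ : {w : InfinitePlace L // IsComplex w} → Perm (Fin 3)}
  (hS : ∀ w ∈ S, w ∈ splitChartPlaces L α) (hρ : ∀ w ∈ S, ρ w = 1)
  (hreg : IsArchGRegular L (endoTorus L S c))
  (hnp : IsArchNormPair L (Matrix.diagonal α) (endoTorus L S c) (gprimeTorus L α S (slotPerm ρ c)))

include hC'G hCH hS hρ hreg hnp in
/-- **THE TWO JUNCTION SCALARS COINCIDE.**  In one frame with (C_H)+(C′G) (binders of ★ `measure_box_partner_eq_of_image_eq` token for token), for a `G`-regular chart point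
`γ_H = endoTorus S c` (`c ∈ RegG S`, presentation `hT : T_S = Z(γ_H)`) and its norm partner `γ′ = gprimeTorus α S (ρ•c)` (`ρ ∈ partnerPerms S`, presentation `hT′ : T_S′ = Z(γ′)`):
the `t′(γ′)`-mass of the `G′`-box `B′_S` (the scalar of ★ PART 2 `classOrbitalIntegral_mul_measure_box_eq_chartOrbG`) EQUALS the `t_H(γ_H)`-mass of the `H`-box `B_S` (the scalar
of ★ PART 2b `classOrbitalIntegral_mul_measure_box_eq_chartOrbH`) — ★ `measure_box_partner_eq_of_image_eq` with the box hypothesis discharged by §5.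
[cite: Rogawski1990, §1.7 p. 6; §4.3 (4.3.1) p. 43; §8.2 p. 122; §14.3 pp. 233–234] [cite: Shelstad1979, §4 pp. 20–23] [cite: LanglandsShelstad1987, §1.3–1.4] -/
theorem map_subgroupCongr_symm_chartBoxImgG_eq
    (hT : chartTorusH L S = Subgroup.centralizer ({endoTorus L S c} : Set (↥(arch (↥(maximalRealSubfield L)) L (IsCMField.complexConj L) 2 (Matrix.of fun i j : Fin 2 => if i.val + j.val + 1 = 2 then (1 : L) else 0)) × ↥(arch (↥(maximalRealSubfield L)) L (IsCMField.complexConj L) 1 (Matrix.of fun i j : Fin 1 => if i.val + j.val + 1 = 1 then (1 : L) else 0)))))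
    (hT' : chartTorusG L α S = Subgroup.centralizer ({gprimeTorus L α S (slotPerm ρ c)} : Set ↥(arch (↥(maximalRealSubfield L)) L (IsCMField.complexConj L) 3 (Matrix.diagonal α)))) :
    (t' (gprimeTorus L α S (slotPerm ρ c))).map ⇑(MulEquiv.subgroupCongr hT').symm (chartBoxImgG L α S) =
      (tH (endoTorus L S c)).map ⇑(MulEquiv.subgroupCongr hT).symm (chartBoxImg L S) := by
  -- the two carried measures, read on the boxes, are pre-image masses
  have hmH : Measurable ⇑(MulEquiv.subgroupCongr hT).symm := (continuous_subtype_val.subtype_mk _ : Continuous ⇑(MulEquiv.subgroupCongr hT).symm).measurable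
  have hmG : Measurable ⇑(MulEquiv.subgroupCongr hT').symm := (continuous_subtype_val.subtype_mk _ : Continuous ⇑(MulEquiv.subgroupCongr hT').symm).measurable
  have hBH : MeasurableSet (chartBoxImg L S) := (isCompact_chartBoxImg L S).isClosed.measurableSet
  have hBG : MeasurableSet (chartBoxImgG L α S) := (isCompact_chartBoxImgG L α S).isClosed.measurableSet
  rw [Measure.map_apply hmG hBG, Measure.map_apply hmH hBH]
  exact measure_box_partner_eq_of_image_eq L (Matrix.diagonal α) t' t tH hd' hd₃ hC'G hCH hreg hnp (hmG hBG)
    (image_comp_preimage_chartBoxImg_eq L α S hd' hd₃ hS hρ hreg hnp hT hT')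

end Scalars

end Literature.NumberTheory.Rogawski1990

end
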